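import Summits.NavierStokesRegularity.NavierStokesRegularity.Theorems.RellichScarScarRigidityVorticityDefectDynamics
import Summits.NavierStokesRegularity.NavierStokesRegularity.Theorems.RellichScarScarRigidityVorticityDefectBounds
import Summits.NavierStokesRegularity.NavierStokesRegularity.Theorems.RellichScarScarRigidityVorticityDefectIBP
import HarnessLib

/-!
# `ScarRigidity`, line `moment-conditioned-rellich` — stub `stub_vorticityDefectDecay` (V-rung):
# the first moments of the antisymmetric gradient vanish, and the assembly of the stub

Crux stmt-NavierStokesRegularity-11717 (route RellichScar): the registered stub `stub_vorticityDefectDecay` of the skeleton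
`Cruxes/ScarRigidity/Lines/moment_conditioned_rellich.lean` (parts 1–4: `…VorticityDefectKinematics`, `…Dynamics`,
`…Bounds`, `…IBP`).  First half (`stub_vorticityDefectFlatness`): the rate `∂ₜDᵏA_ij = DᵏA_ij[G]`,
`‖DᵏA_ij[G(s)]‖ ≤ D(−s)/(‖x‖+√(−s))^{6+k}` of part 2 fed into the flatness-from-rate theorem of part 3 gives
`‖DᵏA_ij(t,x)‖ ≤ K(−t)²/(‖x‖+√(−t))^{6+k}` on the whole slab.  Second half: for `t < 0` the first moments `M(t) = ∫ y_m A_ij(t, y) dy` of the antisymmetric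
gradient `A_ij = ∂ᵢw_j − ∂ⱼw_i` of the twin difference converge absolutely
(`|y_m A_ij| ≤ K(−t)²/(‖y‖+√(−t))⁵`, part 3), are DIFFERENTIABLE with derivative `∫ y_m A_ij[G(t)](y) dy = 0`
(differentiation under the integral sign, dominated on `(3t/2, t/2)` by `D(−3t/2)/(‖y‖+√(−t/2))⁵` through the
rate bound of part 2; the slice identity of part 4), hence constant on `(−∞, 0)`; and
`|M(s)| ≤ K(−s)² ∫(‖y‖+√(−s))⁻⁵ = K I₁ (−s) → 0` as `s ↑ 0` (scaling `∫(‖y‖+a)⁻⁵ dy = a⁻² I₁`).  So `M ≡ 0`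
(`stub_vorticityDefectFirstMoments`); with the quintic flatness of part 3 this is `stub_vorticityDefectDecay`.
-/

noncomputable section

open Set Filter Function MeasureTheory Metric TopologicalSpace
open scoped Topology ContDiff Laplacian InnerProductSpace RealInnerProductSpace
open Literature.Analysis.FluidPDE

set_option linter.dupNamespace false -- D-0017: `Summit.<S>.<S>.…` repeats the summit name by design

-- nested operator types
set_option maxSynthPendingDepth 4

namespace Summit.NavierStokesRegularity.NavierStokesRegularity.Theorems.RellichScarScarRigidity

/-- Physical space (the notation of the skeleton `Cruxes/ScarRigidity/Lines/moment_conditioned_rellich.lean`). -/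
local notation "ℝ³" => EuclideanSpace ℝ (Fin 3)

/-! ### Scaling of the apex-weight integrals -/

/-- **Scaling**: `∫ (‖y‖+a)⁻ᵖ dy = a³/aᵖ ∫ (‖y‖+1)⁻ᵖ dy` on `ℝ³` (`y = a z`). [folklore] -/
theorem integral_inv_norm_add_pow (a : ℝ) (ha : 0 < a) (p : ℕ) :
    ∫ y : EuclideanSpace ℝ (Fin 3), ((‖y‖ + a) ^ p)⁻¹ = a ^ 3 / a ^ p * ∫ y : EuclideanSpace ℝ (Fin 3), ((‖y‖ + 1) ^ p)⁻¹ := by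
  have h := Measure.integral_comp_inv_smul_of_nonneg volume (fun y : EuclideanSpace ℝ (Fin 3) => ((‖y‖ + 1) ^ p)⁻¹) ha.le
  rw [finrank_euclideanSpace, Fintype.card_fin, smul_eq_mul] at h
  have e : ∀ y : EuclideanSpace ℝ (Fin 3), ((‖a⁻¹ • y‖ + 1) ^ p)⁻¹ = a ^ p * ((‖y‖ + a) ^ p)⁻¹ := fun y => by
    rw [norm_smul, norm_inv, Real.norm_of_nonneg ha.le, show a⁻¹ * ‖y‖ + 1 = a⁻¹ * (‖y‖ + a) by field_simp,
      mul_pow, mul_inv, inv_pow, inv_inv]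
  simp_rw [e] at h
  rw [integral_const_mul] at h
  rw [div_mul_eq_mul_div, eq_div_iff (pow_pos ha p).ne', mul_comm]
  exact h

/-- The majorant of the first moments integrates to `O(−t)`:
`∫ X a⁴/(‖y‖+a)⁵ dy = X I₁ a²` with `I₁ = ∫ (‖y‖+1)⁻⁵`. [folklore] -/
theorem integral_apexWeight_five (X a : ℝ) (ha : 0 < a) :
    ∫ y : EuclideanSpace ℝ (Fin 3), X * a ^ 4 / (‖y‖ + a) ^ 5 = X * (∫ y : EuclideanSpace ℝ (Fin 3), ((‖y‖ + 1) ^ 5)⁻¹) * a ^ 2 := by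
  simp_rw [div_eq_mul_inv]
  rw [integral_const_mul, integral_inv_norm_add_pow a ha 5]
  field_simp

/-! ### The first moments of the twins -/

section Twins

variable {V₁ V₂ : ℝ → EuclideanSpace ℝ (Fin 3) → EuclideanSpace ℝ (Fin 3)} {Q₁ Q₂ : ℝ → EuclideanSpace ℝ (Fin 3) → ℝ}

/-- The time lines of the antisymmetric gradient of the twin difference: `∂ₜA_ij(t, y) = A_ij[G(t)](y)`,
`HasDerivAt` form. [folklore] -/
theorem hasDerivAt_antisymGrad_twinDiff (hcl₁ : IsClassicalNSSolutionOn (Iio (0 : ℝ)) 1 0 V₁ Q₁)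
    (hcl₂ : IsClassicalNSSolutionOn (Iio (0 : ℝ)) 1 0 V₂ Q₂) {t : ℝ} (ht : t < 0) (y : EuclideanSpace ℝ (Fin 3)) (i j : Fin 3) :
    HasDerivAt (fun s => (fderiv ℝ (fun z => V₁ s z - V₂ s z) y (EuclideanSpace.single i (1 : ℝ))) j -
        (fderiv ℝ (fun z => V₁ s z - V₂ s z) y (EuclideanSpace.single j (1 : ℝ))) i)
      ((fderiv ℝ (fun y => Δ (fun z => V₁ t z - V₂ t z) y -
            (convect (fun z => V₁ t z - V₂ t z) (V₁ t) y + convect (V₂ t) (fun z => V₁ t z - V₂ t z) y))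
          y (EuclideanSpace.single i (1 : ℝ))) j -
        (fderiv ℝ (fun y => Δ (fun z => V₁ t z - V₂ t z) y -
            (convect (fun z => V₁ t z - V₂ t z) (V₁ t) y + convect (V₂ t) (fun z => V₁ t z - V₂ t z) y))
          y (EuclideanSpace.single j (1 : ℝ))) i) t := by
  have h := (isSmoothSpaceTimeOn_antisymGrad (isSmoothSpaceTimeOn_twinDiff hcl₁ hcl₂) i j).hasDerivAt_timeLine
    isOpen_Iio ht y
  rwa [deriv_antisymGrad_twinDiff_eq hcl₁ hcl₂ ht y i j] at h

/-- **First half of `stub_vorticityDefectDecay` (registered sub-goal `stub_vorticityDefectFlatness`): quintic flatness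
of the antisymmetric gradient on the whole slab**, `‖DᵏA_ij(t,x)‖ ≤ K(−t)²/(‖x‖+√(−t))^{6+k}` — the rate bound
`∂ₜDᵏA_ij = DᵏA_ij[G]`, `‖DᵏA_ij[G(s)]‖ ≤ D(−s)/(‖x‖+√(−s))^{6+k}` (part 2) fed into `vorticityDefect_flatness_of_rate`
(part 3). [folklore] -/
theorem stub_vorticityDefectFlatness :
    ∀ (V₁ V₂ : ℝ → EuclideanSpace ℝ (Fin 3) → EuclideanSpace ℝ (Fin 3))
      (Q₁ Q₂ : ℝ → EuclideanSpace ℝ (Fin 3) → ℝ),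
      IsClassicalNSSolutionOn (Iio (0 : ℝ)) 1 0 V₁ Q₁ → IsClassicalNSSolutionOn (Iio (0 : ℝ)) 1 0 V₂ Q₂ →
      ScaleInvariantBounds V₁ Q₁ → ScaleInvariantBounds V₂ Q₂ → FarDecay 3 V₁ V₂ →
      ∀ k : ℕ, ∃ K : ℝ, ∀ (i j : Fin 3), ∀ t < 0, ∀ x : EuclideanSpace ℝ (Fin 3),
        ‖iteratedFDeriv ℝ k (fun y : EuclideanSpace ℝ (Fin 3) =>
            (fderiv ℝ (fun z => V₁ t z - V₂ t z) y (EuclideanSpace.single i (1 : ℝ))) j -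
            (fderiv ℝ (fun z => V₁ t z - V₂ t z) y (EuclideanSpace.single j (1 : ℝ))) i) x‖ ≤
          K * (-t) ^ 2 / (‖x‖ + Real.sqrt (-t)) ^ (6 + k) := by
  intro V₁ V₂ Q₁ Q₂ hcl₁ hcl₂ hB₁ hB₂ hF k
  obtain ⟨D, hD0, hD⟩ := exists_antisymGrad_rate_bound hcl₁ hcl₂ hB₁ hB₂ hF k
  exact vorticityDefect_flatness_of_rate hcl₁ hcl₂ hB₁ hB₂ hF k hD0 fun s hs x i j =>
    ⟨_, hasDerivAt_iteratedFDeriv_antisymGrad_twinDiff hcl₁ hcl₂ k hs x i j, hD s hs x i j⟩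

/-- **Second half of `stub_vorticityDefectDecay`: the first moments of the antisymmetric gradient converge absolutely
and vanish** on every slice `t < 0`. [folklore] -/
theorem stub_vorticityDefectFirstMoments :
    ∀ (V₁ V₂ : ℝ → EuclideanSpace ℝ (Fin 3) → EuclideanSpace ℝ (Fin 3))
      (Q₁ Q₂ : ℝ → EuclideanSpace ℝ (Fin 3) → ℝ),
      IsClassicalNSSolutionOn (Iio (0 : ℝ)) 1 0 V₁ Q₁ → IsClassicalNSSolutionOn (Iio (0 : ℝ)) 1 0 V₂ Q₂ →
      ScaleInvariantBounds V₁ Q₁ → ScaleInvariantBounds V₂ Q₂ → FarDecay 3 V₁ V₂ →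
      ∀ t < 0, ∀ (m i j : Fin 3),
        Integrable (fun y : EuclideanSpace ℝ (Fin 3) => y m *
            ((fderiv ℝ (fun z => V₁ t z - V₂ t z) y (EuclideanSpace.single i (1 : ℝ))) j -
             (fderiv ℝ (fun z => V₁ t z - V₂ t z) y (EuclideanSpace.single j (1 : ℝ))) i)) volume ∧
        ∫ y : EuclideanSpace ℝ (Fin 3), y m *
            ((fderiv ℝ (fun z => V₁ t z - V₂ t z) y (EuclideanSpace.single i (1 : ℝ))) j -
             (fderiv ℝ (fun z => V₁ t z - V₂ t z) y (EuclideanSpace.single j (1 : ℝ))) i) = 0 := by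
  intro V₁ V₂ Q₁ Q₂ hcl₁ hcl₂ hB₁ hB₂ hF t ht m i j
  obtain ⟨K₀, hK₀⟩ := stub_vorticityDefectFlatness V₁ V₂ Q₁ Q₂ hcl₁ hcl₂ hB₁ hB₂ hF 0
  obtain ⟨D, hD0, hD⟩ := exists_antisymGrad_rate_bound hcl₁ hcl₂ hB₁ hB₂ hF 0
  obtain ⟨C₀, hC₀0, hC₀⟩ := exists_defectSource_bound hcl₁ hcl₂ hB₁ hB₂ hF 0
  obtain ⟨C₁, hC₁0, hC₁⟩ := exists_defectSource_bound hcl₁ hcl₂ hB₁ hB₂ hF 1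
  set K : ℝ := max K₀ 0 with hK
  have hK0 : 0 ≤ K := le_max_right _ _
  have hcoord : ∀ (v : EuclideanSpace ℝ (Fin 3)) (k : Fin 3), ‖v k‖ ≤ ‖v‖ := fun v k => PiLp.norm_apply_le v k
  -- the moment integrand `F` and its time derivative `F'`
  set F : ℝ → EuclideanSpace ℝ (Fin 3) → ℝ := fun s y => y m * ((fderiv ℝ (fun z => V₁ s z - V₂ s z) y (EuclideanSpace.single i (1 : ℝ))) j -
    (fderiv ℝ (fun z => V₁ s z - V₂ s z) y (EuclideanSpace.single j (1 : ℝ))) i) with hF_def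
  set F' : ℝ → EuclideanSpace ℝ (Fin 3) → ℝ := fun s y => y m *
    ((fderiv ℝ (fun y => Δ (fun z => V₁ s z - V₂ s z) y -
        (convect (fun z => V₁ s z - V₂ s z) (V₁ s) y + convect (V₂ s) (fun z => V₁ s z - V₂ s z) y)) y (EuclideanSpace.single i (1 : ℝ))) j -
     (fderiv ℝ (fun y => Δ (fun z => V₁ s z - V₂ s z) y -
        (convect (fun z => V₁ s z - V₂ s z) (V₁ s) y + convect (V₂ s) (fun z => V₁ s z - V₂ s z) y)) y (EuclideanSpace.single j (1 : ℝ))) i)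
    with hF'_def
  -- pointwise bounds
  have hFb : ∀ s < 0, ∀ y, ‖F s y‖ ≤ K * s ^ 2 / (‖y‖ + Real.sqrt (-s)) ^ 5 := by
    intro s hs y
    have hσ : 0 < Real.sqrt (-s) := Real.sqrt_pos.2 (by linarith)
    have h1 := hK₀ i j s hs y
    rw [norm_iteratedFDeriv_zero] at h1
    have h2 : ‖(fderiv ℝ (fun z => V₁ s z - V₂ s z) y (EuclideanSpace.single i (1 : ℝ))) j -
        (fderiv ℝ (fun z => V₁ s z - V₂ s z) y (EuclideanSpace.single j (1 : ℝ))) i‖ ≤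
        K * s ^ 2 / (‖y‖ + Real.sqrt (-s)) ^ (5 + 1) := by
      refine h1.trans ?_
      rw [show (-s) ^ 2 = s ^ 2 by ring]
      exact div_le_div_of_nonneg_right (mul_le_mul_of_nonneg_right (le_max_left _ _) (sq_nonneg _))
        (pow_nonneg (by positivity) _)
    rw [hF_def, norm_mul]
    exact (mul_le_mul (hcoord y m) h2 (norm_nonneg _) (norm_nonneg _)).trans
      (norm_mul_div_apexWeight_succ_le hσ (mul_nonneg hK0 (sq_nonneg _)) 5 y)
  have hF'b : ∀ s < 0, ∀ y, ‖F' s y‖ ≤ D * (-s) / (‖y‖ + Real.sqrt (-s)) ^ 5 := by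
    intro s hs y
    have hσ : 0 < Real.sqrt (-s) := Real.sqrt_pos.2 (by linarith)
    have h1 := hD s hs y i j
    rw [norm_iteratedFDeriv_zero] at h1
    rw [hF'_def, norm_mul]
    exact (mul_le_mul (hcoord y m) h1 (norm_nonneg _) (norm_nonneg _)).trans
      (norm_mul_div_apexWeight_succ_le hσ (mul_nonneg hD0 (by linarith)) 5 y)
  -- continuity of the slices
  have hFc : ∀ s < 0, Continuous (F s) := by
    intro s hs
    have hw : ContDiff ℝ ∞ (fun z => V₁ s z - V₂ s z) := (hcl₁.contDiff_velocity hs).sub (hcl₂.contDiff_velocity hs)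
    exact (EuclideanSpace.proj m : EuclideanSpace ℝ (Fin 3) →L[ℝ] ℝ).continuous.mul
      (contDiff_antisymGrad (n := 0) (hw.of_le (by norm_cast)) i j).continuous
  have hF'c : ∀ s < 0, Continuous (F' s) := by
    intro s hs
    exact (EuclideanSpace.proj m : EuclideanSpace ℝ (Fin 3) →L[ℝ] ℝ).continuous.mul
      (contDiff_antisymGrad (n := 0) ((contDiff_defectSource_slice hcl₁ hcl₂ hs).of_le (by norm_cast)) i j).continuous
  -- integrability of the slices
  have hFi : ∀ s < 0, Integrable (F s) volume := fun s hs =>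
    integrable_of_norm_le_apexWeight (hFc s hs).aestronglyMeasurable (Real.sqrt_pos.2 (by linarith)) (by norm_num)
      (hFb s hs)
  -- differentiation under the integral sign: `M'(s) = ∫ F'(s, y) dy = 0`
  have hderiv : ∀ s < 0, HasDerivAt (fun σ => ∫ y, F σ y) 0 s := by
    intro s hs
    have hb0 : 0 < Real.sqrt (-(s / 2)) := Real.sqrt_pos.2 (by linarith)
    set b : ℝ := Real.sqrt (-(s / 2)) with hb
    have hIoo : Ioo (3 * s / 2) (s / 2) ∈ 𝓝 s := Ioo_mem_nhds (by linarith) (by linarith)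
    have hmeas : ∀ᶠ σ in 𝓝 s, AEStronglyMeasurable (F σ) volume := by
      filter_upwards [Iio_mem_nhds hs] with σ hσ using (hFc σ hσ).aestronglyMeasurable
    have hbound : ∀ᵐ y ∂(volume : Measure (EuclideanSpace ℝ (Fin 3))), ∀ σ ∈ Ioo (3 * s / 2) (s / 2),
        ‖F' σ y‖ ≤ D * (-(3 * s / 2)) / (‖y‖ + b) ^ 5 := by
      refine Eventually.of_forall fun y σ hσ => ?_
      have hσ0 : σ < 0 := by linarith [hσ.2]
      refine (hF'b σ hσ0 y).trans ?_
      have hnum : D * (-σ) ≤ D * (-(3 * s / 2)) := mul_le_mul_of_nonneg_left (by linarith [hσ.1]) hD0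
      have hden : (‖y‖ + b) ^ 5 ≤ (‖y‖ + Real.sqrt (-σ)) ^ 5 := by
        refine pow_le_pow_left₀ (by positivity) ?_ _
        have : b ≤ Real.sqrt (-σ) := Real.sqrt_le_sqrt (by linarith [hσ.2])
        linarith
      exact (div_le_div_of_nonneg_left (mul_nonneg hD0 (by linarith)) (pow_pos (by positivity) _) hden).trans
        (div_le_div_of_nonneg_right hnum (pow_nonneg (by positivity) _))
    have hbi : Integrable (fun y : EuclideanSpace ℝ (Fin 3) => D * (-(3 * s / 2)) / (‖y‖ + b) ^ 5) volume := by
      have hc : Continuous fun y : EuclideanSpace ℝ (Fin 3) => D * (-(3 * s / 2)) / (‖y‖ + b) ^ 5 :=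
        continuous_const.div (by fun_prop) fun y => (pow_pos (by positivity) _).ne'
      refine integrable_of_norm_le_apexWeight (C := D * (-(3 * s / 2))) (p := 5) hc.aestronglyMeasurable hb0
        (by norm_num) fun y => le_of_eq ?_
      rw [Real.norm_of_nonneg (div_nonneg (mul_nonneg hD0 (by linarith)) (pow_nonneg (by positivity) _))]
    have hdiff : ∀ᵐ y ∂(volume : Measure (EuclideanSpace ℝ (Fin 3))), ∀ σ ∈ Ioo (3 * s / 2) (s / 2),
        HasDerivAt (fun σ => F σ y) (F' σ y) σ := by
      refine Eventually.of_forall fun y σ hσ => ?_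
      have hσ0 : σ < 0 := by linarith [hσ.2]
      exact (hasDerivAt_antisymGrad_twinDiff hcl₁ hcl₂ hσ0 y i j).const_mul (y m)
    have key := (hasDerivAt_integral_of_dominated_loc_of_deriv_le hIoo hmeas (hFi s hs)
      (hF'c s hs).aestronglyMeasurable hbound hbi hdiff).2
    rwa [(integral_coord_mul_antisymGrad_defectSource hcl₁ hcl₂ hB₁ hB₂ hF hs m i j hC₀0 hC₁0 (hC₀ s hs)
      (hC₁ s hs)).2] at key
  -- the moments are constant in time …
  have hconst : ∀ s ∈ Iio (0 : ℝ), ∀ s' ∈ Iio (0 : ℝ), (∫ y, F s' y) = ∫ y, F s y := by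
    intro s hs s' hs'
    have h := (convex_Iio (0 : ℝ)).norm_image_sub_le_of_norm_hasDerivWithin_le (f := fun σ => ∫ y, F σ y)
      (f' := fun _ => 0) (C := 0) (fun σ hσ => (hderiv σ hσ).hasDerivWithinAt) (fun σ _ => by simp) hs hs'
    rw [zero_mul, norm_le_zero_iff, sub_eq_zero] at h
    exact h
  -- … and `O(−s)`
  have hsmall : ∀ s < 0, ‖∫ y, F s y‖ ≤ K * (∫ y : EuclideanSpace ℝ (Fin 3), ((‖y‖ + 1) ^ 5)⁻¹) * (-s) := by
    intro s hs
    have hσ : 0 < Real.sqrt (-s) := Real.sqrt_pos.2 (by linarith)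
    have hs2 : s ^ 2 = Real.sqrt (-s) ^ 4 := by
      rw [show (4 : ℕ) = 2 * 2 from rfl, pow_mul, Real.sq_sqrt (by linarith)]; ring
    have hgc : Continuous fun y : EuclideanSpace ℝ (Fin 3) => K * Real.sqrt (-s) ^ 4 / (‖y‖ + Real.sqrt (-s)) ^ 5 :=
      continuous_const.div (by fun_prop) fun y => (pow_pos (by positivity) _).ne'
    have hg : Integrable (fun y : EuclideanSpace ℝ (Fin 3) => K * Real.sqrt (-s) ^ 4 / (‖y‖ + Real.sqrt (-s)) ^ 5) volume := by
      refine integrable_of_norm_le_apexWeight (C := K * Real.sqrt (-s) ^ 4) (p := 5) hgc.aestronglyMeasurable hσ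
        (by norm_num) fun y => le_of_eq ?_
      rw [Real.norm_of_nonneg (div_nonneg (mul_nonneg hK0 (pow_nonneg hσ.le _)) (pow_nonneg (by positivity) _))]
    have h1 : ‖∫ y, F s y‖ ≤ ∫ y : EuclideanSpace ℝ (Fin 3), K * Real.sqrt (-s) ^ 4 / (‖y‖ + Real.sqrt (-s)) ^ 5 :=
      norm_integral_le_of_norm_le hg (Eventually.of_forall fun y => by rw [← hs2]; exact hFb s hs y)
    rwa [integral_apexWeight_five K _ hσ, Real.sq_sqrt (by linarith)] at h1
  -- conclusion: `M(t) = lim_{s ↑ 0} M(s) = 0`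
  refine ⟨hFi t ht, ?_⟩
  have hlim : Tendsto (fun s : ℝ => K * (∫ y : EuclideanSpace ℝ (Fin 3), ((‖y‖ + 1) ^ 5)⁻¹) * (-s)) (𝓝[<] (0 : ℝ)) (𝓝 0) := by
    have hc : Continuous fun s : ℝ => K * (∫ y : EuclideanSpace ℝ (Fin 3), ((‖y‖ + 1) ^ 5)⁻¹) * (-s) :=
      continuous_const.mul continuous_neg
    have := hc.tendsto 0
    rw [neg_zero, mul_zero] at this
    exact this.mono_left nhdsWithin_le_nhds
  have hev : ∀ᶠ s in 𝓝[<] (0 : ℝ), ‖∫ y, F t y‖ ≤ K * (∫ y : EuclideanSpace ℝ (Fin 3), ((‖y‖ + 1) ^ 5)⁻¹) * (-s) := by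
    filter_upwards [self_mem_nhdsWithin] with s hs
    rw [hconst s hs t ht]
    exact hsmall s hs
  exact norm_le_zero_iff.1 (ge_of_tendsto hlim hev)

end Twins

/-- **Registered helper stub `stub_vorticityDefectIBPTools`** of `stub_vorticityDefectDecay`: the slice identities
`∫ y_m ∂ᵢg = −δ_{mi}∫g`, `∫ G_j(t) = 0` and `∫ y_m A_ij[G(t)] = 0` for the defect source of the twins (part 4, with the
global bounds on `G`, `DG` of part 2). [folklore] -/
theorem stub_vorticityDefectIBPTools :
    (∀ (g : EuclideanSpace ℝ (Fin 3) → ℝ) (m i : Fin 3), ContDiff ℝ 1 g → Integrable g volume →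
      Integrable (fun y : EuclideanSpace ℝ (Fin 3) => y m * g y) volume →
      Integrable (fun y : EuclideanSpace ℝ (Fin 3) => y m * fderiv ℝ g y (EuclideanSpace.single i (1 : ℝ))) volume →
      ∫ y : EuclideanSpace ℝ (Fin 3), y m * fderiv ℝ g y (EuclideanSpace.single i (1 : ℝ)) =
        -((EuclideanSpace.single i (1 : ℝ) : EuclideanSpace ℝ (Fin 3)) m * ∫ y, g y)) ∧
    (∀ (V₁ V₂ : ℝ → EuclideanSpace ℝ (Fin 3) → EuclideanSpace ℝ (Fin 3))
      (Q₁ Q₂ : ℝ → EuclideanSpace ℝ (Fin 3) → ℝ),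
      IsClassicalNSSolutionOn (Iio (0 : ℝ)) 1 0 V₁ Q₁ → IsClassicalNSSolutionOn (Iio (0 : ℝ)) 1 0 V₂ Q₂ →
      ScaleInvariantBounds V₁ Q₁ → ScaleInvariantBounds V₂ Q₂ → FarDecay 3 V₁ V₂ → ∀ t < 0,
      (∀ j : Fin 3, Integrable (fun y : EuclideanSpace ℝ (Fin 3) =>
            (fun y => Laplacian.laplacian (fun z => V₁ t z - V₂ t z) y -
              (convect (fun z => V₁ t z - V₂ t z) (V₁ t) y + convect (V₂ t) (fun z => V₁ t z - V₂ t z) y)) y j) volume ∧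
          ∫ y : EuclideanSpace ℝ (Fin 3),
            (fun y => Laplacian.laplacian (fun z => V₁ t z - V₂ t z) y -
              (convect (fun z => V₁ t z - V₂ t z) (V₁ t) y + convect (V₂ t) (fun z => V₁ t z - V₂ t z) y)) y j = 0) ∧
      (∀ m i j : Fin 3,
        Integrable (fun y : EuclideanSpace ℝ (Fin 3) => y m *
          ((fderiv ℝ
              (fun y => Laplacian.laplacian (fun z => V₁ t z - V₂ t z) y -
                (convect (fun z => V₁ t z - V₂ t z) (V₁ t) y + convect (V₂ t) (fun z => V₁ t z - V₂ t z) y)) y (EuclideanSpace.single i (1 : ℝ))) j -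
            (fderiv ℝ
              (fun y => Laplacian.laplacian (fun z => V₁ t z - V₂ t z) y -
                (convect (fun z => V₁ t z - V₂ t z) (V₁ t) y + convect (V₂ t) (fun z => V₁ t z - V₂ t z) y)) y (EuclideanSpace.single j (1 : ℝ))) i)) volume ∧
        ∫ y : EuclideanSpace ℝ (Fin 3), y m *
          ((fderiv ℝ
              (fun y => Laplacian.laplacian (fun z => V₁ t z - V₂ t z) y -
                (convect (fun z => V₁ t z - V₂ t z) (V₁ t) y + convect (V₂ t) (fun z => V₁ t z - V₂ t z) y)) y (EuclideanSpace.single i (1 : ℝ))) j -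
            (fderiv ℝ
              (fun y => Laplacian.laplacian (fun z => V₁ t z - V₂ t z) y -
                (convect (fun z => V₁ t z - V₂ t z) (V₁ t) y + convect (V₂ t) (fun z => V₁ t z - V₂ t z) y)) y (EuclideanSpace.single j (1 : ℝ))) i) = 0)) :=
  ⟨fun _g m i hg hint hm hd => integral_coord_mul_fderiv_apply hg m i hint hm hd,
    fun _V₁ _V₂ _Q₁ _Q₂ hcl₁ hcl₂ hB₁ hB₂ hF _t ht =>
      ⟨fun j => integral_defectSource_coord_eq_zero hcl₁ hcl₂ hB₁ hB₂ hF ht j, fun m i j => by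
        obtain ⟨C₀, hC₀0, hC₀⟩ := exists_defectSource_bound hcl₁ hcl₂ hB₁ hB₂ hF 0
        obtain ⟨C₁, hC₁0, hC₁⟩ := exists_defectSource_bound hcl₁ hcl₂ hB₁ hB₂ hF 1
        exact integral_coord_mul_antisymGrad_defectSource hcl₁ hcl₂ hB₁ hB₂ hF ht m i j hC₀0 hC₁0 (hC₀ _ ht)
          (hC₁ _ ht)⟩⟩

/-! ### The registered stub -/

/-- **V-rung — the vorticity defect is quintically flat and its first moments vanish (pressure-free first rung).**
For two classical pairs on the open slab with the scale-invariant package and cubic flatness of the difference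
`w = V₁ − V₂` (`FarDecay 3`), the antisymmetric gradient `A_ij = ∂_iw_j − ∂_jw_i` satisfies, for every order `k`,
`‖∇ᵏA_ij(t,x)‖ ≤ K(−t)²/(‖x‖+√(−t))^{6+k}` on the whole slab (exterior: integrate `∂ₜA = ΔA − (∇G − ∇Gᵀ)`,
`G = Δw − (V₁·∇V₁ − V₂·∇V₂)`, back from the final slice — the pressure Hessian is symmetric; core: the package), and its
first moments `∫ y_m A_ij(t,y) dy` converge absolutely and vanish for every `t < 0` (they are constant in `t` by two
integrations by parts — `G` is a divergence plus a Laplacian — and are `O(−t)`).  Registered stub of the skeleton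
`Cruxes/ScarRigidity/Lines/moment_conditioned_rellich.lean` (`stub_vorticityDefectFlatness` and
`stub_vorticityDefectFirstMoments`). [folklore mechanism; new statement] -/
theorem stub_vorticityDefectDecay :
    ∀ (V₁ V₂ : ℝ → ℝ³ → ℝ³) (Q₁ Q₂ : ℝ → ℝ³ → ℝ),
      IsClassicalNSSolutionOn (Iio (0 : ℝ)) 1 0 V₁ Q₁ → IsClassicalNSSolutionOn (Iio (0 : ℝ)) 1 0 V₂ Q₂ →
      ScaleInvariantBounds V₁ Q₁ → ScaleInvariantBounds V₂ Q₂ → FarDecay 3 V₁ V₂ →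
      (∀ k : ℕ, ∃ K : ℝ, ∀ (i j : Fin 3), ∀ t < 0, ∀ x : ℝ³,
        ‖iteratedFDeriv ℝ k (fun y : ℝ³ =>
            (fderiv ℝ (fun z => V₁ t z - V₂ t z) y (EuclideanSpace.single i (1 : ℝ))) j -
            (fderiv ℝ (fun z => V₁ t z - V₂ t z) y (EuclideanSpace.single j (1 : ℝ))) i) x‖ ≤
          K * (-t) ^ 2 / (‖x‖ + Real.sqrt (-t)) ^ (6 + k)) ∧
      (∀ t < 0, ∀ (m i j : Fin 3),
        Integrable (fun y : ℝ³ => y m *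
            ((fderiv ℝ (fun z => V₁ t z - V₂ t z) y (EuclideanSpace.single i (1 : ℝ))) j -
             (fderiv ℝ (fun z => V₁ t z - V₂ t z) y (EuclideanSpace.single j (1 : ℝ))) i)) volume ∧
        ∫ y : ℝ³, y m *
            ((fderiv ℝ (fun z => V₁ t z - V₂ t z) y (EuclideanSpace.single i (1 : ℝ))) j -
             (fderiv ℝ (fun z => V₁ t z - V₂ t z) y (EuclideanSpace.single j (1 : ℝ))) i) = 0) :=
  fun V₁ V₂ Q₁ Q₂ hcl₁ hcl₂ hB₁ hB₂ hF =>
    ⟨stub_vorticityDefectFlatness V₁ V₂ Q₁ Q₂ hcl₁ hcl₂ hB₁ hB₂ hF,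
      stub_vorticityDefectFirstMoments V₁ V₂ Q₁ Q₂ hcl₁ hcl₂ hB₁ hB₂ hF⟩

end Summit.NavierStokesRegularity.NavierStokesRegularity.Theorems.RellichScarScarRigidity

end
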